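import Literature.AlgebraicGeometry.GroupSchemes.GroupSchemeActionStabilizer
import Literature.AlgebraicGeometry.GroupSchemes.GeneralLinearGroupSchemeBaseChange
import HarnessLib

/-!
# Stabilizers commute with base change (Mumford–Fogarty–Kirwan, Definition 0.4, after base change)

Mumford–Fogarty–Kirwan, *GIT*, Ch. 0 §1, Def. 0.4 (p. 3) defines the stabilizer `S(x) = G ×_{ψ_x, X, x} S`
of a point `x` of `X` under an action `σ : G × X → X`; Görtz–Wedhorn I, (4.15) (p. 116): after a base
change `S' → S`, `(G ×_S S', m_{(S')}, …)` is a group scheme over `S'` with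
`(G ×_S S')_{S'}(T) = G_S(T)`, and Definition 4.44 (p. 117): an action is a morphism `G ×_S X → X`
inducing group actions on `T`-valued points.  Base change is a monoidal right adjoint
(`Over.map g ⊣ Over.pullback g`), so it carries actions to actions, sections to sections, orbit maps
to orbit maps and the fibre product `S(x)` to the fibre product: `S(x) ×_S S' = S(x ×_S S')`.
In the tree `Stabilizer.stab G x` (p760124) is the stabilizer with `stabι`, `stabLift`, `stabPoints`,
`grpObjStab`; base-changed group structures are Mathlib's scoped `Functor.grpObjObj`; the transported
group laws on points are `adjunction_homEquiv_mul/_one` (p761310).  This file adds the ACTION side,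
everything proved (no `sorry`, no new axiom, no named fact):

* §1 (any lax monoidal `F : D ⥤ C`, `[MonObj M] [ModObj M X]`): the transported action
  **`ActionBaseChange.actionObj F M X : ModObj (F.obj M) (F.obj X)`** (`smul := μ_F ≫ F(γ)`; a reducible
  `abbrev`, NOT an instance — like Mathlib's `Functor.monObjObj` minus the scoped attribute; this file
  activates it by `attribute [local instance]`, consumers by `letI := actionObj F M X`), with
  (cartesian `C`, `D`, `F` monoidal) **`map_smul_points : F.map (g • y) = F.map g • F.map y`** and, for an
  adjunction `L ⊣ F`, **`homEquiv_smul`**, `homEquiv_symm_smul`; the transported section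
  **`mapSection F X x := ε F ≫ F.map x : 𝟙 ⟶ F X`** with `map_toUnit_comp`, `homEquiv_toUnit_comp`;
* §2 **`Stabilizer.map_orbitMap : F.map (orbitMap G x) = orbitMap (F.obj G) (mapSection F X x)`**,
  `Stabilizer.isMonHom_stabLift` (the universal property among group objects, cf.
  `GroupSchemeKernel.isMonHom_kerLift`), then **`stabComparison F G x : F.obj (stab M x) ⟶ stab (F.obj M)
  (mapSection F x)`** (`= stabLift (F.map (stabι M x))`), its inverse **`stabComparisonInv adj x`** by
  transposition, **`stabComparisonIso adj x : F.obj (stab M x) ≅ stab (F.obj M) (mapSection F x)`**,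
  `isMonHom_stabComparison(_Inv)`, and the points dictionary
  `homEquiv_symm_comp_stabComparisonInv_comp_stabι`;
* §3 (schemes, `g : S' ⟶ S`): **`Stabilizer.baseChangeIso g G x : (Over.pullback g).obj (stab G x) ≅
  stab ((Over.pullback g).obj G) (mapSection (Over.pullback g) x)`**, `isMonHom_baseChangeIso_hom/_inv`,
  `baseChangeIso_hom_comp_stabι`.

## References

* D. Mumford, J. Fogarty, F. Kirwan, *Geometric Invariant Theory*, 3rd ed., Springer (1994): Ch. 0
  §1, Def. 0.3 (actions) and Def. 0.4 (p. 3). [MumfordFogartyKirwan1994]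
* U. Görtz, T. Wedhorn, *Algebraic Geometry I: Schemes*, 2nd ed. (2020): (4.15) (p. 116),
  Definition 4.44 and 4.45 (p. 117). [GortzWedhorn2020]

## Design notes

* Consumers (cell hodgecm-mathlib, F-DAG capital): MFK Def. 0.8 freeness/properness after base
  change (F-7 (7b)), stabilizers of torsion sections / frames moved along `T → S` (F-8), the
  finite-flat "closed conditions" wrappers.
* The action on `F X` is NOT an instance, global or scoped (a global one would equip every `F.obj X`
  with an action; typer lint rule: port files export no instance / instance attribute — B-plan1 (g15)
  ruling 2026-08-30): `actionObj` is a reducible `abbrev`; THIS file opts in with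
  `attribute [local instance] ActionBaseChange.actionObj` (section-local: §1 twice, §§2–3 once), a consumer
  opts in with `letI := ActionBaseChange.actionObj F M X` (or the same file-local attribute), the way
  `Functor.monObjObj/grpObjObj` are opt-in.
* Mathlib / Literature searches: Mathlib has `Functor.monObjObj/grpObjObj`, `Functor.map_mul`,
  `Functor.Monoidal.lift_μ`, `toUnit_ε`, `εIso`, `ModObj.comp_smul`, `MonoidalCategory.selfLeftAction_*`;
  no transported `ModObj` along a functor, no stabilizer objects.  Literature: `Stabilizer.*`
  (p760124), `adjunction_homEquiv_mul/_one/_symm_*` (p761310), `isMonHom_of_points` (p758973).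
  Nothing is restated.
-/

universe v₁ v₂ u₁ u₂ u

open CategoryTheory Limits Opposite MonoidalCategory CartesianMonoidalCategory AlgebraicGeometry

noncomputable section

namespace Literature.AlgebraicGeometry.GroupSchemes

open scoped MonObj Obj

/-! ### §1 Base change of an action, of a section and of the orbit map -/

namespace ActionBaseChange

section LaxMonoidal

variable {D : Type u₂} [Category.{v₂} D] [MonoidalCategory D] {C : Type u₁} [Category.{v₁} C]
  [MonoidalCategory C] (F : D ⥤ C) [F.LaxMonoidal] (M X : D) [MonObj M] [ModObj M X]

/-- **The transported action of `F M` on `F X`** along a lax monoidal functor `F`: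
`F M ⊗ F X → F (M ⊗ X) → F X` (the base change `σ_{(S')}` of an action `σ`). A reducible definition,
not an instance: use `letI := actionObj F M X` (this file: `attribute [local instance] actionObj`).
[cite: GortzWedhorn2020, (4.15), p. 116 and Definition 4.44, p. 117] -/
abbrev actionObj : ModObj (F.obj M) (F.obj X) where
  smul := Functor.LaxMonoidal.μ F M X ≫ F.map γ[M, X]
  one_smul := by
    have h1 := ModObj.one_smul (M := M) X
    simp only [MonoidalCategory.selfLeftAction_actionHomLeft,
      MonoidalCategory.selfLeftAction_actionUnitIso] at h1 ⊢
    simp [← F.map_comp, h1]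
  mul_smul := by
    have hms := ModObj.mul_smul (M := M) X
    simp only [MonoidalCategory.selfLeftAction_actionHomLeft,
      MonoidalCategory.selfLeftAction_actionHomRight, MonoidalCategory.selfLeftAction_actionAssocIso]
      at hms ⊢
    simp_rw [Functor.obj.μ_def, comp_whiskerRight, Category.assoc,
      Functor.LaxMonoidal.μ_natural_left_assoc, MonoidalCategory.whiskerLeft_comp, Category.assoc,
      Functor.LaxMonoidal.μ_natural_right_assoc]
    slice_lhs 3 4 => rw [← F.map_comp, hms]
    simp

attribute [local instance] actionObj

/-- Unfolding the transported action map: `γ[F M, F X] = μ_F ≫ F(γ[M, X])`.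
[cite: GortzWedhorn2020, (4.15), p. 116 and Definition 4.44, p. 117] -/
theorem smul_def : γ[F.obj M, F.obj X] = Functor.LaxMonoidal.μ F M X ≫ F.map γ[M, X] := rfl

variable {M} in
/-- **The transported section**: a point `x : 𝟙 → X` gives the point `ε_F ≫ F(x) : 𝟙 → F X`
(`x ×_S S'`). [cite: GortzWedhorn2020, (4.15), p. 116] -/
def mapSection (x : 𝟙_ D ⟶ X) : 𝟙_ C ⟶ F.obj X :=
  Functor.LaxMonoidal.ε F ≫ F.map x

variable {M} in
/-- Unfolding `mapSection`. [cite: GortzWedhorn2020, (4.15), p. 116] -/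
theorem mapSection_def (x : 𝟙_ D ⟶ X) : mapSection F X x = Functor.LaxMonoidal.ε F ≫ F.map x := rfl

end LaxMonoidal

section Cartesian

variable {D : Type u₂} [Category.{v₂} D] [CartesianMonoidalCategory D] {C : Type u₁} [Category.{v₁} C]
  [CartesianMonoidalCategory C] (F : D ⥤ C) [F.Monoidal] {M X : D} [MonObj M] [ModObj M X]

attribute [local instance] actionObj

/-- **`F` is equivariant on points**: `F(g · y) = F(g) · F(y)` for `g : T → M`, `y : T → X`
(Görtz–Wedhorn Def. 4.44: actions are read on `T`-valued points).
[cite: GortzWedhorn2020, (4.15), p. 116 and Definition 4.44, p. 117] -/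
theorem map_smul_points {T : D} (g : T ⟶ M) (y : T ⟶ X) : F.map (g • y) = F.map g • F.map y := by
  rw [Hom.smul_def, Hom.smul_def, smul_def, F.map_comp, ← Functor.Monoidal.lift_μ_assoc]

/-- `F(x_T) = (ε ≫ F x)_{F T}`: the transported section read over `F T`. [cite: GortzWedhorn2020, (4.15), p. 116] -/
theorem map_toUnit_comp {T : D} (x : 𝟙_ D ⟶ X) :
    F.map (toUnit T ≫ x) = toUnit (F.obj T) ≫ mapSection F X x := by
  rw [F.map_comp, mapSection_def, ← Category.assoc, Functor.Monoidal.toUnit_ε]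

variable {F} {L : C ⥤ D} (adj : L ⊣ F)

/-- **Transposition along `L ⊣ F` is equivariant**: `(a · y)♯ = a♯ · y♯` for `a : L T → M`,
`y : L T → X` (GW (4.15): `(G ×_S S')_{S'}(T) = G_S(T)` compatibly with the actions).
[cite: GortzWedhorn2020, (4.15), p. 116 and Definition 4.44, p. 117] -/
theorem homEquiv_smul {T : C} (a : L.obj T ⟶ M) (y : L.obj T ⟶ X) :
    adj.homEquiv T X (a • y) = adj.homEquiv T M a • adj.homEquiv T X y := by
  have hu : ∀ {Y : D} (f : L.obj T ⟶ Y),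
      adj.homEquiv T Y f = adj.homEquiv T (L.obj T) (𝟙 _) ≫ F.map f := fun f => by
    rw [← adj.homEquiv_naturality_right, Category.id_comp]
  rw [hu, hu a, hu y, map_smul_points, ModObj.comp_smul]

/-- The inverse transposition is equivariant. [cite: GortzWedhorn2020, (4.15), p. 116 and Definition 4.44, p. 117] -/
theorem homEquiv_symm_smul {T : C} (a : T ⟶ F.obj M) (y : T ⟶ F.obj X) :
    (adj.homEquiv T X).symm (a • y) = (adj.homEquiv T M).symm a • (adj.homEquiv T X).symm y := by
  apply (adj.homEquiv T X).injective
  rw [Equiv.apply_symm_apply, homEquiv_smul, Equiv.apply_symm_apply, Equiv.apply_symm_apply]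

/-- The transpose of `x_{L T}` is `(x_F)_T`: `(toUnit (L T) ≫ x)♯ = toUnit T ≫ (ε ≫ F x)`.
[cite: GortzWedhorn2020, (4.15), p. 116] -/
theorem homEquiv_toUnit_comp {T : C} (x : 𝟙_ D ⟶ X) :
    adj.homEquiv T X (toUnit (L.obj T) ≫ x) = toUnit T ≫ mapSection F X x := by
  have h1 : adj.homEquiv T (𝟙_ D) (toUnit (L.obj T)) = toUnit T ≫ Functor.LaxMonoidal.ε F := by
    rw [← cancel_mono (Functor.Monoidal.εIso F).inv]
    exact toUnit_unique _ _
  rw [adj.homEquiv_naturality_right, h1, mapSection_def, Category.assoc]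

end Cartesian

end ActionBaseChange

/-! ### §2 The stabilizer comparison `F (S(x)) ≅ S(x_F)` -/

namespace Stabilizer

open ActionBaseChange

attribute [local instance] ActionBaseChange.actionObj

section General

variable {D : Type u₂} [Category.{v₂} D] [CartesianMonoidalCategory D] {C : Type u₁} [Category.{v₁} C]
  [CartesianMonoidalCategory C]

/-- **The universal property of `S(x)` among group objects**: a homomorphism `φ : K → G` stabilizing
`x` factors through `S(x)` by a homomorphism. [cite: MumfordFogartyKirwan1994, Ch. 0 §1, Def. 0.4 (p. 3)] -/
theorem isMonHom_stabLift {G X K : D} [GrpObj G] [ModObj G X] (x : 𝟙_ D ⟶ X)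
    [HasPullback (orbitMap G x) x] [MonObj K] (φ : K ⟶ G) [IsMonHom φ]
    (hφ : φ • (toUnit K ≫ x) = toUnit K ≫ x) : IsMonHom (stabLift φ hφ) := by
  refine isMonHom_of_points (stabLift φ hφ) (fun T => ?_) (fun T a b => ?_)
  · apply stab_hom_ext
    rw [Category.assoc, stabLift_ι, MonObj.one_comp, MonObj.one_comp]
  · apply stab_hom_ext
    rw [Category.assoc, stabLift_ι, MonObj.mul_comp, MonObj.mul_comp, Category.assoc, stabLift_ι,
      Category.assoc, stabLift_ι]

/-- **The orbit map commutes with base change**: `F(ψ_x) = ψ_{x_F}` for the transported action and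
section. [cite: MumfordFogartyKirwan1994, Ch. 0 §1, Def. 0.4 (p. 3)] -/
theorem map_orbitMap (F : D ⥤ C) [F.Monoidal] (G : D) {X : D} [GrpObj G] [ModObj G X] (x : 𝟙_ D ⟶ X) :
    F.map (orbitMap G x) = orbitMap (F.obj G) (mapSection F X x) := by
  change F.map ((𝟙 G) • (toUnit G ≫ x)) = (𝟙 (F.obj G)) • (toUnit (F.obj G) ≫ mapSection F X x)
  rw [map_smul_points, F.map_id, map_toUnit_comp]

variable (F : D ⥤ C) [F.Monoidal] (G : D) {X : D} [GrpObj G] [ModObj G X] (x : 𝟙_ D ⟶ X)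
  [HasPullback (orbitMap G x) x]
  [HasPullback (orbitMap (F.obj G) (mapSection F X x)) (mapSection F X x)]

omit [HasPullback (orbitMap (F.obj G) (mapSection F X x)) (mapSection F X x)] in
/-- `F(ι)` stabilizes the transported section. [cite: MumfordFogartyKirwan1994, Ch. 0 §1, Def. 0.4 (p. 3)] -/
theorem map_stabι_smul :
    F.map (stabι G x) • (toUnit (F.obj (stab G x)) ≫ mapSection F X x) =
      toUnit (F.obj (stab G x)) ≫ mapSection F X x := by
  rw [← map_toUnit_comp, ← map_smul_points, stabι_smul]

/-- **The comparison morphism `F(S(x)) → S(x_F)`**: the lift of `F(ι)`.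
[cite: MumfordFogartyKirwan1994, Ch. 0 §1, Def. 0.4 (p. 3)] -/
def stabComparison : F.obj (stab G x) ⟶ stab (F.obj G) (mapSection F X x) :=
  stabLift (F.map (stabι G x)) (map_stabι_smul F G x)

/-- `stabComparison ≫ ι = F(ι)`. [cite: MumfordFogartyKirwan1994, Ch. 0 §1, Def. 0.4 (p. 3)] -/
@[simp]
theorem stabComparison_comp_stabι :
    stabComparison F G x ≫ stabι (F.obj G) (mapSection F X x) = F.map (stabι G x) :=
  stabLift_ι _ _

/-- **The comparison morphism is a homomorphism of group objects.**
[cite: MumfordFogartyKirwan1994, Ch. 0 §1, Def. 0.4 (p. 3)] -/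
theorem isMonHom_stabComparison : IsMonHom (stabComparison F G x) :=
  isMonHom_stabLift _ (F.map (stabι G x)) (map_stabι_smul F G x)

variable {F} {L : C ⥤ D} (adj : L ⊣ F)

omit [HasPullback (orbitMap G x) x] in
/-- The transpose of `ι : S(x_F) → F G` stabilizes `x`. [cite: MumfordFogartyKirwan1994, Ch. 0 §1, Def. 0.4 (p. 3)] -/
theorem homEquiv_symm_stabι_smul :
    (adj.homEquiv (stab (F.obj G) (mapSection F X x)) G).symm (stabι (F.obj G) (mapSection F X x)) •
        (toUnit (L.obj (stab (F.obj G) (mapSection F X x))) ≫ x) =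
      toUnit (L.obj (stab (F.obj G) (mapSection F X x))) ≫ x := by
  apply (adj.homEquiv (stab (F.obj G) (mapSection F X x)) X).injective
  rw [homEquiv_smul, Equiv.apply_symm_apply, homEquiv_toUnit_comp, stabι_smul]

/-- **The inverse comparison `S(x_F) → F(S(x))`**, by transposition along `L ⊣ F`.
[cite: MumfordFogartyKirwan1994, Ch. 0 §1, Def. 0.4 (p. 3)] -/
def stabComparisonInv : stab (F.obj G) (mapSection F X x) ⟶ F.obj (stab G x) :=
  adj.homEquiv (stab (F.obj G) (mapSection F X x)) (stab G x)
    (stabLift ((adj.homEquiv (stab (F.obj G) (mapSection F X x)) G).symm (stabι (F.obj G) (mapSection F X x)))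
      (homEquiv_symm_stabι_smul G x adj))

/-- The transpose of `stabComparisonInv` composed with `ι` is the transpose of `ι`.
[cite: MumfordFogartyKirwan1994, Ch. 0 §1, Def. 0.4 (p. 3)] -/
theorem homEquiv_symm_stabComparisonInv_comp_stabι :
    (adj.homEquiv (stab (F.obj G) (mapSection F X x)) (stab G x)).symm (stabComparisonInv G x adj) ≫
        stabι G x =
      (adj.homEquiv (stab (F.obj G) (mapSection F X x)) G).symm (stabι (F.obj G) (mapSection F X x)) := by
  rw [stabComparisonInv, Equiv.symm_apply_apply, stabLift_ι]

/-- `stabComparisonInv ≫ F(ι) = ι`. [cite: MumfordFogartyKirwan1994, Ch. 0 §1, Def. 0.4 (p. 3)] -/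
@[simp]
theorem stabComparisonInv_comp_map_stabι :
    stabComparisonInv G x adj ≫ F.map (stabι G x) = stabι (F.obj G) (mapSection F X x) := by
  rw [stabComparisonInv, ← Adjunction.homEquiv_naturality_right, stabLift_ι, Equiv.apply_symm_apply]

/-- `stabComparison ≫ stabComparisonInv = 𝟙`. [cite: MumfordFogartyKirwan1994, Ch. 0 §1, Def. 0.4 (p. 3)] -/
@[simp]
theorem stabComparison_comp_inv :
    stabComparison F G x ≫ stabComparisonInv G x adj = 𝟙 (F.obj (stab G x)) := by
  apply (adj.homEquiv (F.obj (stab G x)) (stab G x)).symm.injective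
  apply stab_hom_ext
  rw [Adjunction.homEquiv_naturality_left_symm, Category.assoc,
    homEquiv_symm_stabComparisonInv_comp_stabι, ← Adjunction.homEquiv_naturality_left_symm,
    stabComparison_comp_stabι, ← Category.id_comp (F.map (stabι G x)),
    Adjunction.homEquiv_naturality_right_symm]

/-- `stabComparisonInv ≫ stabComparison = 𝟙`. [cite: MumfordFogartyKirwan1994, Ch. 0 §1, Def. 0.4 (p. 3)] -/
@[simp]
theorem stabComparisonInv_comp :
    stabComparisonInv G x adj ≫ stabComparison F G x = 𝟙 (stab (F.obj G) (mapSection F X x)) := by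
  apply stab_hom_ext
  rw [Category.assoc, stabComparison_comp_stabι, stabComparisonInv_comp_map_stabι, Category.id_comp]

/-- **Stabilizers commute with monoidal right adjoints**: `F(S(x)) ≅ S(x_F)`.
[cite: MumfordFogartyKirwan1994, Ch. 0 §1, Def. 0.4 (p. 3)] -/
def stabComparisonIso : F.obj (stab G x) ≅ stab (F.obj G) (mapSection F X x) where
  hom := stabComparison F G x
  inv := stabComparisonInv G x adj
  hom_inv_id := stabComparison_comp_inv G x adj
  inv_hom_id := stabComparisonInv_comp G x adj

/-- The forward map of `stabComparisonIso` is `stabComparison`. [cite: MumfordFogartyKirwan1994, Ch. 0 §1, Def. 0.4 (p. 3)] -/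
@[simp]
theorem stabComparisonIso_hom : (stabComparisonIso G x adj).hom = stabComparison F G x := rfl

/-- The inverse map of `stabComparisonIso` is `stabComparisonInv`. [cite: MumfordFogartyKirwan1994, Ch. 0 §1, Def. 0.4 (p. 3)] -/
@[simp]
theorem stabComparisonIso_inv : (stabComparisonIso G x adj).inv = stabComparisonInv G x adj := rfl

/-- `stabComparisonIso.inv` is a homomorphism of group objects. [cite: MumfordFogartyKirwan1994, Ch. 0 §1, Def. 0.4 (p. 3)] -/
theorem isMonHom_stabComparisonInv : IsMonHom (stabComparisonInv G x adj) :=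
  haveI : IsMonHom (stabComparisonIso G x adj).hom := isMonHom_stabComparison F G x
  (inferInstance : IsMonHom (stabComparisonIso G x adj).inv)

/-- **Points dictionary**: for a `T`-valued point `k` of `S(x_F)`, the `G`-point under the transposed
point `(k ≫ stabComparisonInv)♭ : L T → S(x)` is the transpose of `k ≫ ι`.
[cite: MumfordFogartyKirwan1994, Ch. 0 §1, Def. 0.4 (p. 3)] -/
theorem homEquiv_symm_comp_stabComparisonInv_comp_stabι {T : C}
    (k : T ⟶ stab (F.obj G) (mapSection F X x)) :
    (adj.homEquiv T (stab G x)).symm (k ≫ stabComparisonInv G x adj) ≫ stabι G x =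
      (adj.homEquiv T G).symm (k ≫ stabι (F.obj G) (mapSection F X x)) := by
  rw [Adjunction.homEquiv_naturality_left_symm, Category.assoc,
    homEquiv_symm_stabComparisonInv_comp_stabι, ← Adjunction.homEquiv_naturality_left_symm]

end General

/-! ### §3 Base change of stabilizers of `S`-group-scheme actions -/

section Schemes

variable {S S' : Scheme.{u}} (g : S' ⟶ S) (G : Over S) {X : Over S} [GrpObj G] [ModObj G X]
  (x : 𝟙_ (Over S) ⟶ X)

/-- **Stabilizers commute with base change**: `S(x) ×_S S' ≅ S(x ×_S S')` over `S'`, for the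
base-changed action (`ActionBaseChange.actionObj (Over.pullback g)`) and section
(`mapSection (Over.pullback g) X x`). [cite: MumfordFogartyKirwan1994, Ch. 0 §1, Def. 0.4 (p. 3)] -/
def baseChangeIso :
    (Over.pullback g).obj (stab G x) ≅
      stab ((Over.pullback g).obj G) (mapSection (Over.pullback g) X x) :=
  stabComparisonIso G x (Over.mapPullbackAdj g)

/-- `baseChangeIso.hom ≫ ι = ι ×_S S'`. [cite: MumfordFogartyKirwan1994, Ch. 0 §1, Def. 0.4 (p. 3)] -/
@[simp]
theorem baseChangeIso_hom_comp_stabι :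
    (baseChangeIso g G x).hom ≫ stabι ((Over.pullback g).obj G) (mapSection (Over.pullback g) X x) =
      (Over.pullback g).map (stabι G x) :=
  stabComparison_comp_stabι _ _ _

/-- **`baseChangeIso.hom` is a homomorphism of `S'`-group schemes.** [cite: MumfordFogartyKirwan1994, Ch. 0 §1, Def. 0.4 (p. 3)] -/
theorem isMonHom_baseChangeIso_hom : IsMonHom (baseChangeIso g G x).hom :=
  isMonHom_stabComparison _ _ _

/-- **`baseChangeIso.inv` is a homomorphism of `S'`-group schemes.** [cite: MumfordFogartyKirwan1994, Ch. 0 §1, Def. 0.4 (p. 3)] -/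
theorem isMonHom_baseChangeIso_inv : IsMonHom (baseChangeIso g G x).inv :=
  isMonHom_stabComparisonInv _ _ _

/-- **Points dictionary over `S'`** (transposes along `Over.map g ⊣ Over.pullback g`).
[cite: MumfordFogartyKirwan1994, Ch. 0 §1, Def. 0.4 (p. 3)] -/
theorem homEquiv_symm_comp_baseChangeIso_inv_comp_stabι {T : Over S'}
    (k : T ⟶ stab ((Over.pullback g).obj G) (mapSection (Over.pullback g) X x)) :
    ((Over.mapPullbackAdj g).homEquiv T (stab G x)).symm (k ≫ (baseChangeIso g G x).inv) ≫ stabι G x =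
      ((Over.mapPullbackAdj g).homEquiv T G).symm
        (k ≫ stabι ((Over.pullback g).obj G) (mapSection (Over.pullback g) X x)) :=
  homEquiv_symm_comp_stabComparisonInv_comp_stabι _ _ _ _

end Schemes

end Stabilizer

end Literature.AlgebraicGeometry.GroupSchemes
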